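import Literature.Probability.LatticeModels.PlanarIsingDiscApprox
import Literature.Analysis.Complex.RiemannMapping
import HarnessLib

/-!
# `isConformallyCovariant_chiPlusCorr` as stated forces the one-point function to vanish

`Literature.Probability.LatticeModels.isConformallyCovariant_chiPlusCorr` (`PlanarIsing.lean`) vendors
"the CHI limit family `chiPlusCorr` is conformally covariant with exponent `1/8`"
(Chelkak–Hongler–Izyurov, *Conformal invariance of spin correlations in the planar Ising model*,
Ann. of Math. 181 (2015) 1087–1138 = arXiv:1202.2838 (CHI), Thm 1.3, eq. (1.2); Remark 1.2 (ii))
as `IsConformallyCovariant (1/8) chiPlusCorr`, i.e. between **all** pairs of admissible domains,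
where `chiPlusCorr Ω n a` is the `limUnder` of the renormalised discrete correlations computed on
the tree's **fixed** discretisation `meshDomain Ω δ`. CHI's covariance (1.2) concerns the continuum
functions `⟨σ_{a₀}⋯σ_{a_k}⟩⁺_Ω`, identified with limits of discrete correlations only for discrete
domains that *approximate* `Ω` ("`∂Ω_δ → ∂Ω` in the Hausdorff sense", CHI §2, p. 13 of the arXiv
version; Thms 1.1, 1.3). The Erratum of `PlanarIsing.lean` records informally that the unrestricted
form is therefore not a consequence of CHI and is false on paper. This file makes that precise:

* `chiPlusCorr_ball_zero_eq_zero_of_covariant`: **unconditionally**,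
  `isConformallyCovariant_chiPlusCorr → chiPlusCorr 𝔻 1 ![0] = 0`. Mechanism: the slit unit disc
  `SlitDisc.domain` of `PlanarIsingSlitDisc.lean` has literally the same `chiPlusCorr` as the disc
  (`SlitDisc.chiPlusCorr_domain`: no mesh point lies on the slit, the mesh graph only sees `Ω̄`),
  but there is an explicit conformal bijection `ψ` of the slit disc onto the disc with `ψ 0 = 0` and
  `|ψ'(0)| = 25/16 ≠ 1` (`SlitDisc.exists_isConformalBijection_ball`: `ψ = cayley ∘ (5/4 ·) ∘ unif`
  with the uniformising map `SlitDisc.unif` of that file), so covariance reads `X = (25/16)^{-1/8} X`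
  for `X = chiPlusCorr 𝔻 1 ![0]`.
* `chiPlusCorr_onePoint_eq_zero_of_covariant`: hence, by the Riemann mapping theorem
  (`Complex.exists_bijOn_ball_of_isSimplyConnected`, `Literature/Analysis/Complex/RiemannMapping`)
  and covariance once more, `chiPlusCorr Ω 1 ![a] = 0` for **every** admissible `Ω` and `a ∈ Ω`:
  the fact as stated says that the renormalised magnetisation `δ^{-1/8} 𝔼⁺_{Ω_δ}[σ_a]` has
  `limUnder` zero everywhere.
* `not_isConformallyCovariant_chiPlusCorr_of_hausdorff`, `not_isConformallyCovariant_chiPlusCorr_of`: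
  this contradicts CHI's theorem itself — under the corrected one-point fact
  `chi_halfplane_onePoint_hausdorff` (equivalently under the named facts `chi_onePoint_rho` = CHI
  Thm 1.3 (`k = 0`) and `wu_rhoCHI` = CHI Remark 1.2 (iii), via `chi_halfplane_onePoint_hausdorff_of`)
  the disc, which does satisfy `MeshApproximates` (`meshApproximates_ball`,
  `PlanarIsingDiscApprox.lean`), has `chiPlusCorr 𝔻 1 ![0] = 𝒞 > 0`
  (`chiPlusCorr_ball_eq_of_hausdorff`). So `isConformallyCovariant_chiPlusCorr` is refuted
  conditionally on CHI Thm 1.3 + Wu, and cannot be discharged.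
* `isConformallyCovariant_chiPlusCorr_of_chi_conformal_invariance` (the interim derivation kept as
  a comment in `PlanarIsing.lean`, restored as a theorem) and hence the same conditional refutation
  `not_chi_conformal_invariance_of` of `Literature.Probability.LatticeModels.chi_conformal_invariance`.

* (Appended 2026-08-15.) `tendsto_onePoint_zero_of_chi_conformal_invariance`: what
  `chi_conformal_invariance` forces at the level of the discrete model — for **every** admissible `Ω`
  and `a ∈ Ω` the renormalised magnetisation `δ^{-1/8} 𝔼⁺_{Ω_δ}[σ_a]` actually **tends to `0`** as
  `δ → 0⁺` (under `chi_conformal_invariance` the `limUnder` above is a genuine limit), against CHI's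
  positive limit `𝒞 · 2^{1/4} rad(a, Ω)^{-1/8}` for approximating discretisations (arXiv v3 of CHI,
  §1 p. 3; Thm 1.2 p. 6; "approximates" = `∂Ω_δ → ∂Ω` Hausdorff, §2.6 p. 18); and the resulting
  interface for an *unconditional* refutation, `not_chi_conformal_invariance_of_frequently_le`: it
  suffices to exhibit one admissible `Ω`, one `a ∈ Ω` and one `c > 0` with
  `δ^{-1/8} 𝔼⁺_{Ω_δ}[σ_a] ≥ c` frequently as `δ → 0⁺`, i.e. the sharp one-arm lower bound
  `𝔼⁺_{Ω_δ}[σ_a] ≥ c δ^{1/8}` along some sequence of meshes — which the tree does not have (its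
  unconditional critical lower bounds, `criticalTwoPoint_lower`, are of Simon type, exponent `d - 1`).

The corrected, CHI-faithful covariance statement is already in the tree:
`Literature.Probability.LatticeModels.chiPlusCorr_covariant_of_hausdorff` (`PlanarIsingOnePoint.lean`,
covariance of `chiPlusCorr` between admissible domains satisfying `MeshApproximates`, proved from
`chi_conformal_invariance_hausdorff`, itself proved from `chi_multiPoint_rho` and `wu_rhoCHI`).
Nothing here is a new named fact; all statements are proved.

Verdict clean-up (2026-08-15): `isConformallyCovariant_chiPlusCorr` and `chi_conformal_invariance`
are now `@[deprecated]` records in `PlanarIsing.lean` (mis-stated; replacements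
`chiPlusCorr_covariant_of_hausdorff`, `chi_conformal_invariance_hausdorff` of
`PlanarIsingOnePoint.lean`). The theorems of this file are ABOUT those records (what they force,
and their conditional refutations), so they must name them: `linter.deprecated` is silenced on
exactly these nine declarations and nowhere else. REMOVE-WHEN the deprecated defs are deleted.

## References

* D. Chelkak, C. Hongler, K. Izyurov, *Conformal invariance of spin correlations in the planar
  Ising model*, Ann. of Math. (2) 181 (2015), 1087–1138; arXiv:1202.2838: Thm 1.3 with eq. (1.2),
  Remark 1.2 (ii)–(iii), eq. (1.3), §2 p. 13 (Hausdorff approximation of `Ω` by `Ω_δ`).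
* L. V. Ahlfors, *Complex Analysis*, 3rd ed. (1979), Ch. 3 §3 (Cayley transform), Ch. 6 §1.1
  Thm 1 (Riemann mapping theorem).
-/

noncomputable section

open Filter Metric Set Complex
open _root_.Topology
open Literature.Probability.LatticeModels Literature.Probability.RandomPlanarGeometry

namespace Literature.Probability.LatticeModels

/-! ### The Cayley transform near `i` -/

/-- The derivative of the Cayley transform `z ↦ (z - i)/(z + i)`: `cayley'(w) = 2i/(w + i)²` for
`w ≠ -i`. (Ahlfors, *Complex Analysis* (1979), Ch. 3 §3.) [folklore] -/
theorem hasDerivAt_cayleyFun {w : ℂ} (hw : w + I ≠ 0) :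
    HasDerivAt cayleyFun (2 * I / (w + I) ^ 2) w := by
  have h1 : HasDerivAt (fun z : ℂ => z - I) 1 w := (hasDerivAt_id w).sub_const I
  have h2 : HasDerivAt (fun z : ℂ => z + I) 1 w := (hasDerivAt_id w).add_const I
  have h3 : HasDerivAt (fun z : ℂ => (z - I) / (z + I))
      ((1 * ((fun z : ℂ => z + I) w) - (fun z : ℂ => z - I) w * 1) / ((fun z : ℂ => z + I) w) ^ 2)
      w := h1.div h2 hw
  have hfun : (fun z : ℂ => (z - I) / (z + I)) = cayleyFun := rfl
  rw [hfun] at h3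
  refine h3.congr_deriv ?_
  simp only
  congr 1
  ring

namespace SlitDisc

/-! ### An explicit conformal map of the slit disc onto the disc fixing the centre -/

/-- **The slit disc is conformally equivalent to the disc by a map fixing `0` with
`|ψ'(0)| = 25/16`** (so `rad(0, slit disc) = 16/25`): take `ψ = cayley ∘ (w ↦ 5w/4) ∘ unif`, where
`unif` is the explicit uniformising map `SlitDisc.domain → ℍ` of `PlanarIsingSlitDisc.lean`
(`unif 0 = 4i/5`, `|unif'(0)| = 5/2`), the dilation `w ↦ 5w/4` is an automorphism of `ℍ` moving
`4i/5` to `i`, and the Cayley transform `ℍ → 𝔻` sends `i ↦ 0` with `|cayley'(i)| = 1/2`.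
(Ahlfors 1979, Ch. 3 §3, Ch. 6 §1.) [folklore] -/
theorem exists_isConformalBijection_ball :
    ∃ ψ : ℂ → ℂ, IsConformalBijection ψ domain (ball (0 : ℂ) 1) ∧ ψ 0 = 0 ∧
      ‖deriv ψ 0‖ = 25 / 16 := by
  obtain ⟨hUd, hUb⟩ := isConformalBijection_unif
  -- the dilation `w ↦ 5w/4` is a bijection of `ℍ`
  have hpos : ∀ {w : ℂ}, 0 < w.im → 0 < ((5 / 4 : ℝ) * w : ℂ).im := fun hw => by
    rw [im_ofReal_mul]; positivity
  have hD : BijOn (fun w : ℂ => ((5 / 4 : ℝ) : ℂ) * w) UpperHalfPlane.upperHalfPlaneSet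
      UpperHalfPlane.upperHalfPlaneSet := by
    refine ⟨fun w hw => hpos hw, fun w₁ _ w₂ _ h => mul_left_cancel₀ (by norm_num) h, fun η hη => ?_⟩
    refine ⟨((4 / 5 : ℝ) : ℂ) * η, ?_, ?_⟩
    · show 0 < (((4 / 5 : ℝ) : ℂ) * η).im
      have hη' : 0 < η.im := hη
      rw [im_ofReal_mul]; positivity
    · show ((5 / 4 : ℝ) : ℂ) * (((4 / 5 : ℝ) : ℂ) * η) = η
      rw [← mul_assoc, ← ofReal_mul]; norm_num
  have hC : BijOn cayleyFun UpperHalfPlane.upperHalfPlaneSet (ball (0 : ℂ) 1) := cayley.bijOn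
  -- the Cayley transform at `i`: `cayley i = 0`, `|cayley'(i)| = |2i/(2i)²| = 1/2`
  have hI : I + I ≠ 0 := add_I_ne_zero (by simp)
  have hcI : cayleyFun I = 0 := by rw [cayleyFun_apply, sub_self, zero_div]
  have hdcI : ‖deriv cayleyFun I‖ = 1 / 2 := by
    rw [(hasDerivAt_cayleyFun hI).deriv, norm_div, norm_pow, norm_mul, Complex.norm_I,
      Complex.norm_two, mul_one]
    have : ‖I + I‖ = 2 := by
      rw [← two_mul, norm_mul, Complex.norm_two, Complex.norm_I, mul_one]
    rw [this]
    norm_num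
  refine ⟨fun z => cayleyFun (((5 / 4 : ℝ) : ℂ) * unif z), ⟨?_, ?_⟩, ?_, ?_⟩
  · -- holomorphy on the slit disc
    intro z hz
    have hU : DifferentiableAt ℂ unif z := (hUd z hz).differentiableAt (isOpen_domain.mem_nhds hz)
    have hw : 0 < (((5 / 4 : ℝ) : ℂ) * unif z).im := hpos (hUb.mapsTo hz)
    have hc : DifferentiableAt ℂ cayleyFun (((5 / 4 : ℝ) : ℂ) * unif z) :=
      (hasDerivAt_cayleyFun (add_I_ne_zero hw.le)).differentiableAt
    exact (hc.comp z (hU.const_mul _)).differentiableWithinAt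
  · -- bijectivity: composite of three bijections
    exact hC.comp (hD.comp hUb)
  · -- `ψ 0 = cayley (5/4 · 4i/5) = cayley i = 0`
    show cayleyFun (((5 / 4 : ℝ) : ℂ) * unif 0) = 0
    rw [unif_zero, ← mul_assoc]
    have : ((5 / 4 : ℝ) : ℂ) * (4 / 5 : ℂ) = 1 := by push_cast; norm_num
    rw [this, one_mul, hcI]
  · -- `|ψ'(0)| = |cayley'(i)| · (5/4) · |unif'(0)| = (1/2)(5/4)(5/2)`
    have hB : HasDerivAt (fun z => ((5 / 4 : ℝ) : ℂ) * unif z) (((5 / 4 : ℝ) : ℂ) * deriv unif 0) 0 :=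
      hasDerivAt_unif_zero.differentiableAt.hasDerivAt.const_mul _
    have hy : I = ((5 / 4 : ℝ) : ℂ) * unif 0 := by
      rw [unif_zero, ← mul_assoc]
      have : ((5 / 4 : ℝ) : ℂ) * (4 / 5 : ℂ) = 1 := by push_cast; norm_num
      rw [this, one_mul]
    have hψ : HasDerivAt (cayleyFun ∘ fun z => ((5 / 4 : ℝ) : ℂ) * unif z)
        (deriv cayleyFun I * (((5 / 4 : ℝ) : ℂ) * deriv unif 0)) 0 :=
      (hasDerivAt_cayleyFun hI).differentiableAt.hasDerivAt.comp_of_eq 0 hB hy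
    show ‖deriv (cayleyFun ∘ fun z => ((5 / 4 : ℝ) : ℂ) * unif z) 0‖ = 25 / 16
    rw [hψ.deriv, norm_mul, norm_mul, hdcI, norm_deriv_unif_zero,
      Complex.norm_real, Real.norm_eq_abs, abs_of_pos (by norm_num)]
    norm_num

end SlitDisc

/-! ### Covariance as stated forces `chiPlusCorr Ω 1 ![a] = 0` -/

-- names the `@[deprecated]` record on purpose (verdict clean-up 2026-08-15); REMOVE-WHEN the def is deleted
set_option linter.deprecated false in
/-- **Covariance between all admissible domains kills the disc one-point function.** If the CHI
limit family `chiPlusCorr` were conformally covariant between *all* admissible domains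
(`isConformallyCovariant_chiPlusCorr`, which omits CHI's approximation hypothesis, §2 p. 13 of
arXiv:1202.2838), then `chiPlusCorr 𝔻 1 ![0] = 0`: the slit disc and the disc have the same
`chiPlusCorr` (`SlitDisc.chiPlusCorr_domain`) but are related by a conformal bijection fixing `0`
with derivative of modulus `25/16 ≠ 1` there, so covariance reads `X = (25/16)^{-1/8} X`. [folklore] -/
theorem chiPlusCorr_ball_zero_eq_zero_of_covariant (h : isConformallyCovariant_chiPlusCorr) :
    chiPlusCorr (ball (0 : ℂ) 1) 1 ![0] = 0 := by
  obtain ⟨ψ, hψ, hψ0, hdψ⟩ := SlitDisc.exists_isConformalBijection_ball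
  have key := h SlitDisc.domain (ball 0 1) ψ SlitDisc.isAdmissibleDomain_domain
    SlitDisc.isAdmissibleDomain_ball hψ 1 ![0] (Function.injective_of_subsingleton _)
    (fun i => by simpa using SlitDisc.zero_mem_domain)
  have hvec : (fun i : Fin 1 => ψ ((![(0 : ℂ)] : Fin 1 → ℂ) i)) = ![0] := by
    funext i
    simp [hψ0]
  rw [hvec, Fin.prod_univ_one, Matrix.cons_val_fin_one, hdψ, SlitDisc.chiPlusCorr_domain] at key
  -- key : X = (25/16)^(-1/8) * X
  have hlt : (25 / 16 : ℝ) ^ (-(1 / 8 : ℝ)) < 1 :=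
    Real.rpow_lt_one_of_one_lt_of_neg (by norm_num) (by norm_num)
  have hX : chiPlusCorr (ball (0 : ℂ) 1) 1 ![0] * (1 - (25 / 16 : ℝ) ^ (-(1 / 8 : ℝ))) = 0 := by
    linear_combination key
  rcases mul_eq_zero.1 hX with h0 | h0
  · exact h0
  · exact absurd h0 (by linarith)

-- names the `@[deprecated]` record on purpose (verdict clean-up 2026-08-15); REMOVE-WHEN the def is deleted
set_option linter.deprecated false in
/-- **Covariance as stated kills the one-point function everywhere.** Under
`isConformallyCovariant_chiPlusCorr`, `chiPlusCorr Ω 1 ![a] = 0` for every admissible `Ω` and every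
`a ∈ Ω`: map `Ω` onto `𝔻` with `a ↦ 0` by the Riemann mapping theorem
(`Complex.exists_bijOn_ball_of_isSimplyConnected`, with `f'(a) ≠ 0`) and use covariance together
with `chiPlusCorr_ball_zero_eq_zero_of_covariant`. In words: the fact as vendored asserts that the
renormalised magnetisation `δ^{-1/8} 𝔼⁺_{Ω_δ}[σ_a]` has `limUnder` zero for all `Ω`, `a` — the
opposite of CHI's `𝒞₁ rad(a, Ω)^{-1/8}` (arXiv:1202.2838, p. 3). (Ahlfors 1979, Ch. 6 §1.1 Thm 1
for the Riemann map.) [folklore] -/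
theorem chiPlusCorr_onePoint_eq_zero_of_covariant (h : isConformallyCovariant_chiPlusCorr)
    {Ω : Set ℂ} (hΩ : IsAdmissibleDomain Ω) {a : ℂ} (ha : a ∈ Ω) : chiPlusCorr Ω 1 ![a] = 0 := by
  obtain ⟨hopen, hbdd, -, hsc⟩ := id hΩ
  have hne : Ω ≠ univ := fun hU => NormedSpace.unbounded_univ ℝ ℂ (hU ▸ hbdd)
  obtain ⟨f, hf, hbij, hfa, hf', -⟩ := Complex.exists_bijOn_ball_of_isSimplyConnected hopen hsc hne ha
  have key := h Ω (ball 0 1) f hΩ SlitDisc.isAdmissibleDomain_ball ⟨hf, hbij⟩ 1 ![a]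
    (Function.injective_of_subsingleton _) (fun i => by simpa using ha)
  have hvec : (fun i : Fin 1 => f ((![a] : Fin 1 → ℂ) i)) = ![0] := by
    funext i
    simp [hfa]
  rw [hvec, chiPlusCorr_ball_zero_eq_zero_of_covariant h, Fin.prod_univ_one,
    Matrix.cons_val_fin_one] at key
  -- key : 0 = ‖f'(a)‖^(-1/8) * chiPlusCorr Ω 1 ![a]
  have hpos : 0 < ‖deriv f a‖ ^ (-(1 / 8 : ℝ)) :=
    Real.rpow_pos_of_pos (norm_pos_iff.2 (hf' a ha)) _
  exact (mul_eq_zero.1 key.symm).resolve_left hpos.ne'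

/-! ### Conditional refutations from CHI Theorem 1.3 and Wu's asymptotics -/

-- names the `@[deprecated]` record on purpose (verdict clean-up 2026-08-15); REMOVE-WHEN the def is deleted
set_option linter.deprecated false in
/-- **`isConformallyCovariant_chiPlusCorr` contradicts the (corrected) CHI one-point theorem.**
Under `chi_halfplane_onePoint_hausdorff` (CHI Thm 1.3, `k = 0`, eqs. (1.2)–(1.3), Remark 1.2 (iii),
with CHI's approximation hypothesis) the unit disc — which satisfies `MeshApproximates`
(`meshApproximates_ball`) — has `chiPlusCorr 𝔻 1 ![0] = 𝒞 · (1 - 0)^{-1/8} = 𝒞 > 0`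
(`chiPlusCorr_ball_eq_of_hausdorff`), whereas covariance as stated forces `0`.
[cite: ChelkakHonglerIzyurovAnnals2015, Thm. 1.3 (k = 0) with eqs. (1.2)–(1.3) and Rem. 1.2 (iii); §2 p. 13] -/
theorem not_isConformallyCovariant_chiPlusCorr_of_hausdorff (h : chi_halfplane_onePoint_hausdorff) :
    ¬ isConformallyCovariant_chiPlusCorr := fun hcov => by
  obtain ⟨C, hC, H⟩ := chiPlusCorr_ball_eq_of_hausdorff h
  have h0 := H 0 (mem_ball_self one_pos)
  rw [chiPlusCorr_ball_zero_eq_zero_of_covariant hcov, norm_zero] at h0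
  norm_num at h0
  exact absurd h0.symm hC.ne'

-- names the `@[deprecated]` record on purpose (verdict clean-up 2026-08-15); REMOVE-WHEN the def is deleted
set_option linter.deprecated false in
/-- **Conditional refutation of `isConformallyCovariant_chiPlusCorr` from the two named CHI facts**:
CHI Thm 1.3 (`k = 0`) in the `ϱ`-normalisation (`chi_onePoint_rho`) and Wu's asymptotics
`ϱ(δ) ∼ 𝒞₂ δ^{1/4}` (`wu_rhoCHI`, CHI Remark 1.2 (iii)) imply `¬ isConformallyCovariant_chiPlusCorr`.
Hence the fact cannot be discharged; its CHI-faithful form is `chiPlusCorr_covariant_of_hausdorff`.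
[cite: ChelkakHonglerIzyurovAnnals2015, Thm. 1.3 (k = 0), Rem. 1.2 (iii); §2 p. 13] -/
theorem not_isConformallyCovariant_chiPlusCorr_of (h₁ : chi_onePoint_rho) (h₂ : wu_rhoCHI) :
    ¬ isConformallyCovariant_chiPlusCorr :=
  not_isConformallyCovariant_chiPlusCorr_of_hausdorff (chi_halfplane_onePoint_hausdorff_of h₁ h₂)

-- names the `@[deprecated]` record on purpose (verdict clean-up 2026-08-15); REMOVE-WHEN the def is deleted
set_option linter.deprecated false in
/-- The unrestricted convergence-with-covariance statement `chi_conformal_invariance` implies the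
unrestricted covariance of the limit family (uniqueness of limits; this is the interim derivation
recorded as a comment in `PlanarIsing.lean`). (CHI Thm 1.3, eq. (1.2).)
[cite: ChelkakHonglerIzyurovAnnals2015, Thm. 1.3 eq. (1.2)] -/
theorem isConformallyCovariant_chiPlusCorr_of_chi_conformal_invariance (h : chi_conformal_invariance) :
    isConformallyCovariant_chiPlusCorr := by
  obtain ⟨S, C, -, hS, h⟩ := h
  have key : ∀ Ω, IsAdmissibleDomain Ω → ∀ n (a : Fin n → ℂ), Function.Injective a →
      (∀ i, a i ∈ Ω) → chiPlusCorr Ω n a = C ^ n * S Ω n a :=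
    fun Ω hΩ n a ha haΩ => (h Ω hΩ n a ha haΩ).limUnder_eq
  intro Ω Ω' φ hΩ hΩ' hφ n a ha haΩ
  have ha' : Function.Injective fun i => φ (a i) :=
    fun i j hij => ha (hφ.2.injOn (haΩ i) (haΩ j) hij)
  rw [key Ω hΩ n a ha haΩ, key Ω' hΩ' n _ ha' fun i => hφ.2.mapsTo (haΩ i),
    hS Ω Ω' φ hΩ hΩ' hφ n a ha haΩ]
  ring

-- names the `@[deprecated]` record on purpose (verdict clean-up 2026-08-15); REMOVE-WHEN the def is deleted
set_option linter.deprecated false in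
/-- Hence `chi_conformal_invariance` (convergence on *all* admissible domains with the fixed scheme
`meshDomain`) is likewise refuted by the corrected CHI one-point theorem
`chi_halfplane_onePoint_hausdorff`. [cite: ChelkakHonglerIzyurovAnnals2015, Thm. 1.3 (k = 0) with eqs. (1.2)–(1.3) and Rem. 1.2 (iii); §2 p. 13] -/
theorem not_chi_conformal_invariance_of_hausdorff (h : chi_halfplane_onePoint_hausdorff) :
    ¬ chi_conformal_invariance := fun h' =>
  not_isConformallyCovariant_chiPlusCorr_of_hausdorff h
    (isConformallyCovariant_chiPlusCorr_of_chi_conformal_invariance h')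

-- names the `@[deprecated]` record on purpose (verdict clean-up 2026-08-15); REMOVE-WHEN the def is deleted
set_option linter.deprecated false in
/-- Conditional refutation of `chi_conformal_invariance` from `chi_onePoint_rho` (CHI Thm 1.3,
`k = 0`) and `wu_rhoCHI` (CHI Remark 1.2 (iii)).
[cite: ChelkakHonglerIzyurovAnnals2015, Thm. 1.3 (k = 0), Rem. 1.2 (iii); §2 p. 13] -/
theorem not_chi_conformal_invariance_of (h₁ : chi_onePoint_rho) (h₂ : wu_rhoCHI) :
    ¬ chi_conformal_invariance :=
  not_chi_conformal_invariance_of_hausdorff (chi_halfplane_onePoint_hausdorff_of h₁ h₂)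

/-! ### What `chi_conformal_invariance` forces for the discrete model, and the interface for an
unconditional refutation (appended 2026-08-15) -/

-- names the `@[deprecated]` record on purpose (verdict clean-up 2026-08-15); REMOVE-WHEN the def is deleted
set_option linter.deprecated false in
/-- **`chi_conformal_invariance` forces the renormalised magnetisation to vanish everywhere.** Under
`chi_conformal_invariance` (convergence with covariance on *all* admissible domains, fixed scheme
`meshDomain`), for every admissible `Ω` and every `a ∈ Ω`,
`δ^{-1/8} 𝔼⁺_{Ω_δ}[σ_a] → 0` as `δ → 0⁺`: the statement makes the renormalised one-point function
converge (to `𝒞 · S Ω 1 ![a] = chiPlusCorr Ω 1 ![a]`), and that limit is `0` by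
`chiPlusCorr_onePoint_eq_zero_of_covariant` with
`isConformallyCovariant_chiPlusCorr_of_chi_conformal_invariance`. CHI prove the opposite for
discretisations approximating `Ω`: the limit is `𝒞 · 2^{1/4} rad(a, Ω)^{-1/8} > 0` (arXiv:1202.2838v3,
§1 p. 3 and Thm 1.2 p. 6, "as `Ω_δ` approximates `Ω`", i.e. `∂Ω_δ → ∂Ω` in the Hausdorff sense,
§2.6 p. 18) — the hypothesis `chi_conformal_invariance` omits.
[cite: ChelkakHonglerIzyurovAnnals2015, arXiv v3: Thm 1.2 (p. 6), §1 p. 3, §2.6 p. 18] -/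
theorem tendsto_onePoint_zero_of_chi_conformal_invariance (h : chi_conformal_invariance)
    {Ω : Set ℂ} (hΩ : IsAdmissibleDomain Ω) {a : ℂ} (ha : a ∈ Ω) :
    Tendsto (fun δ : ℝ => δ ^ (-(1 : ℝ) / 8) * meshIsingPlusCorr Ω δ ![a]) (𝓝[>] 0) (𝓝 0) := by
  have h0 : chiPlusCorr Ω 1 ![a] = 0 :=
    chiPlusCorr_onePoint_eq_zero_of_covariant
      (isConformallyCovariant_chiPlusCorr_of_chi_conformal_invariance h) hΩ ha
  obtain ⟨S, C, -, -, hconv⟩ := h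
  have h1 := hconv Ω hΩ 1 ![a] (Function.injective_of_subsingleton _) (fun i => by simpa using ha)
  simp only [Nat.cast_one, pow_one] at h1
  have h2 : chiPlusCorr Ω 1 ![a] = C * S Ω 1 ![a] := by
    unfold chiPlusCorr
    simp only [Nat.cast_one]
    exact h1.limUnder_eq
  rw [← h2, h0] at h1
  exact h1

-- names the `@[deprecated]` record on purpose (verdict clean-up 2026-08-15); REMOVE-WHEN the def is deleted
set_option linter.deprecated false in
/-- **Interface for an unconditional refutation of `chi_conformal_invariance`.** It suffices to
exhibit one admissible domain `Ω`, one point `a ∈ Ω` and one constant `c > 0` such that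
`c ≤ δ^{-1/8} 𝔼⁺_{Ω_δ}[σ_a]` frequently as `δ → 0⁺` — i.e. the sharp one-arm lower bound
`𝔼⁺_{Ω_δ}[σ_a] ≥ c δ^{1/8}` along some sequence of meshes (the exponent `1/8` of CHI's
magnetisation asymptotics, arXiv:1202.2838v3 §1 p. 3). The tree's unconditional critical lower
bounds are of Simon type (`criticalTwoPoint_lower`, exponent `d - 1`) and do not reach it, which is
why the refutations above remain conditional on CHI's theorem (`chi_onePoint_rho`) and Wu's
asymptotics (`wu_rhoCHI`). [folklore] -/
theorem not_chi_conformal_invariance_of_frequently_le {Ω : Set ℂ} (hΩ : IsAdmissibleDomain Ω)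
    {a : ℂ} (ha : a ∈ Ω) {c : ℝ} (hc : 0 < c)
    (hfreq : ∃ᶠ δ in 𝓝[>] (0 : ℝ), c ≤ δ ^ (-(1 : ℝ) / 8) * meshIsingPlusCorr Ω δ ![a]) :
    ¬ chi_conformal_invariance := fun h => by
  have hev : ∀ᶠ δ in 𝓝[>] (0 : ℝ), δ ^ (-(1 : ℝ) / 8) * meshIsingPlusCorr Ω δ ![a] < c :=
    (tendsto_onePoint_zero_of_chi_conformal_invariance h hΩ ha).eventually (gt_mem_nhds hc)
  obtain ⟨δ, hle, hlt⟩ := (hfreq.and_eventually hev).exists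
  exact absurd hlt (not_lt.2 hle)

end Literature.Probability.LatticeModels
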